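import Literature.MathematicalPhysics.QuantumFieldTheory.Balaban1983to89.B10Eq25WalkGeometryTorus

/-!
# `Balaban1983to89.B10Eq24GraphTerms` — [Balaban1985UV3] p. 262, (24)–(25) FOR GRAPHS WITH SEVERAL LINES: «The
# localizations {□_j} and the walks ω replacing lines of the graph define a localization X of the considered expression.
# This localization is simply a union of all these sets. … Summing the expressions with the same localization X we get
# finally the inequality (24)» — the per-cube shape `B13.LogHalfBound` is STABLE under the union-resummed product of
# boundedly many localized families (the lines of a graph), with explicit constants; on the periodic carrier the gluing
# input (2.27) is a theorem (`TreeLengthTorusGeometry.torusTreeLen_biUnion_add_two_le`), and (23) per line ⇒ (25) ⇒ (65)₁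
# for the ℓ-line families follows BY NAME

statement-level skeleton of published theorems with citation tags; proofs where landed; nothing here is a claim about
the Yang–Mills mass gap.

CITATION HEADER (lean-in-tree rule 2026-08-18).  T. Bałaban, *Ultraviolet stability of three-dimensional lattice pure
gauge field theories*, Commun. Math. Phys. **102**, 255–275 (1985), bib `Balaban1985UV3` (cell paper B10; journal page =
PDF page + 254; p. 262 = PDF p. 8, p. 273 = PDF p. 19); [Balaban1988RG2Cluster] (2.27) p. 18 (the gluing inequality for
the linear size of a connected union); [Dimock2013] App. A Cor. 26 (the anchored entropy sum, typed in `B12TreeDecay`).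
The sentences were re-read on the tree's own verbatim quotations (`B10Eq25Rate`, `B10LogDet63` §3, `B10Eq65PolymerSum`,
`TreeLengthTorusGeometry` Part 3); nothing of the manuscripts is asserted as a fact: the expansion, its graphs and the bound
(23) for their lines stay hypotheses (`B10Eq25Rate.WalkTermBound23`, one per line); everything below is finite
combinatorics and real arithmetic, PROVED.

THE PRINTED TEXT (p. 262 [PDF 8], verbatim).  «Each expression corresponds to a graph with vertices localized in cubes
{□_j}. A line of the graph connecting vertices □_i, □_j is replaced by a random walk ω = ((α₀, X₀), (α₁, X₁), …, (αₙ, Xₙ))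
[…] A term in the expression, corresponding to the walk ω, satisfies the bound (3.108) [5], i.e. can be bounded by
O(1)O(M₁^{−(1/2)})^{|ω|}M₁^{−(1/2)|ω|} exp(−½δ₀d(ω, □_i, □_j)), (23) […] The localizations {□_j} and the walks ω replacing
lines of the graph define a localization X of the considered expression. This localization is simply a union of all these
sets. It is easy to see that, because of the bound (23), the expressions corresponding to big localization sets X are very
small […] Summing the expressions with the same localization X we get finally the inequality (24) […] With this definition
we have |𝒫′₁(g₀, X, U₁)| ≦ O(g₀)e^{−κ𝓛(X)} (25)»; the graphs come from «the cumulant expansion formula (3.24) [8], again up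
to the sixth order in g₀» (p. 262), so the number of lines is BOUNDED.  The cell's kernel edge (23) ⇒ (25)
(`B10Eq25Rate`, `B10LogDet63` §3) is typed, by its own docstring, for ONE walk per term: *"graphs with SEVERAL lines …: the
per-term inequality §3 applies line by line, but the regrouping §4 is typed for ONE walk per term — the finite product
version is not typed"*.  THIS FILE types the finite product version.

WHAT WAS ALREADY IN THE TREE (used BY NAME).  The per-cube shape `B13.LogHalfBound D sp E nX B r` (‖E(X,φ)‖ ≤ B·nX(X)·
e^{−r d(X)} on `sp X`) and its algebra (`B10LogDet63.logHalfBound_mono`); the single-line regrouping (`B10LogDet63.Elog`,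
`B10Eq25Rate.rate25` ∕ `logHalfBound_of_bound23`) and its torus geometry (`B10Eq25WalkGeometryTorus`: `stateNbrs`, `single`,
`domOf`, `cubesQ`, `card_cubesQ`, `card_stateNbrs_torus_share_le`, `card_anchors_le_one`, `single_mem_cubesQ_domOf`,
`rescaleLaw_torus`, `volBoundK1_torus`); the cube systems `B12TreeDecay.CubeSystem` with the anchored entropy sum
`ineq126_touches` ([Dimock2013] Cor. 26: Σ_{Y ∩ W ≠ ∅} e^{−κ d(Y)} ≤ K₀(c₀,Δ)·#W for κ ≥ κ₀(c₀,Δ), modulo `DegreeLE Δ`,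
`VolumeLeaf c₀`); the torus catalogue (`TreeLengthTorus.tsys` ∕ `tcubeSys` ∕ `tdegreeLE` ∕ `tvolumeLeaf` ∕ `card_tcube`) with the
gluing inequality (2.27) PROVED (`TreeLengthTorusGeometry.torusTreeLen_biUnion_add_two_le`: d(⋃𝐃) + 2 ≤ Σ_{Y∈𝐃}(d(Y) + 2)
for a family 𝐃 with connected union) and the union lemma `B10Eq25WalkGeometryTorus.tFaceConnected_union`; (25)'s carrier
`B13.bound118_of_logHalfBound` ∕ `B10Eq25Rate.bound25_of_bound118` and (65)₁ `B10Eq65PolymerSum.norm_total_le_of_bound25`;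
`Real.pow_div_factorial_le_exp`.

WHAT IS HERE (all PROVED).
* §1 `one_add_pow_mul_exp_neg_le` (private calculus): `(1+t)^m e^{−at} ≤ m!·e^a∕a^m`.
* §2 THE UNION-RESUMMED PRODUCT of `ℓ` localized families over a cube system `G` — «This localization is simply a union of
  all these sets … Summing the expressions with the same localization X»: `covTuples G ℓ X` = the `ℓ`-tuples of domains
  whose cube families cover exactly the cubes of `X`, `prodFam G E X φ = Σ_{t ∈ covTuples} Π_i E_i(t_i, φ)`;
  `subset_of_mem_covTuples`.  The GLUING hypothesis `hglue` of §3 ((2.27) for covering tuples: d(X) + 2 ≤ Σ_i (d(t_i) + 2),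
  [Balaban1988RG2Cluster] p. 18 — a theorem on the torus, §4) and the SPACE-RESTRICTION hypothesis `hsp` of §3 (the analyticity space of a larger domain lies in
  that of a smaller one — [Balaban1988RG2Cluster] p. 15's restriction property) are carried inline (no `def … : Prop`).
* §3 **`logHalfBound_prodFam`** — THE PRODUCT VERSION OF THE REGROUPING: if every factor obeys `LogHalfBound` with constant
  `B_i ≥ 0` at rate `r₁ + κ`, `r₁ ≥ κ₀(c₀,Δ)`, `κ > 0`, then `prodFam` obeys `LogHalfBound` with count `#cubes`, rate `κ∕2` and the
  EXPLICIT constant `(Π_i B_i)·K₀(c₀,Δ)^ℓ·e^{2κ(ℓ−1)}·c₀^{2ℓ−1}·(2ℓ−1)!·e^{κ∕2}∕(κ∕2)^{2ℓ−1}` (ℓ ≥ 1; `DegreeLE`, `VolumeLeaf`,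
  `hglue`, `hsp`).  Mechanism: factor norms ≤ B_i·#(t_i)·e^{−(r₁+κ)d(t_i)}; `#(t_i) ≤ #X`; the κ-parts glue to
  `e^{2κ(ℓ−1)}e^{−κd(X)}` by (2.27); the r₁-parts are summed over ALL tuples of domains inside X (`Finset.prod_univ_sum`),
  each coordinate sum `≤ K₀·#X` by `ineq126_touches`; the surplus power `(#X)^{2ℓ−1} ≤ (c₀(1+d(X)))^{2ℓ−1}` is paid by half
  the rate (§1).  (`logHalfBound_count_mono`, private: changing the count function by a constant factor.)
* §4 THE TORUS: `glue227_torus` ((2.27) for covering tuples on `tcubeSys d N`, from `torusTreeLen_biUnion_add_two_le`: tuples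
  ↦ their image family), **`logHalfBound_prodFam_torus`** (Δ = 2d, c₀ = 4·2^d).
* §5 **`bound25_prodFam_torus`** ((25) for the product family: `B10.Bound25Printed` with rate `κ∕2 − 1` via
  `bound118_of_logHalfBound` + `tvolumeLeaf` + `bound25_of_bound118`) and **`norm_total_prodFam_torus`** ((65)₁:
  `‖Σ_X prodFam(X, U)‖ ≤ C·g·K₀·N^d`, `norm_total_le_of_bound25` over `tcubeSys`).
* §6 THE p. 262 READING: for `ℓ` LINES, each a family of anchored walk terms on the torus walk states of
  `B10Eq25WalkGeometryTorus` (share-a-block successor lists, labelled one-block anchors) obeying (23) (`WalkTermBound23` with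
  its own prefactor `A_i`), the line families `E_i := B10LogDet63.Elog … (term i)` obey `LogHalfBound` at any rate past the
  entropy threshold (`logHalfBound_line_torus`, = `B10Eq25Rate.rate25` with the torus binders discharged and the count
  rescaled to `#blocks`), hence **`logHalfBound_graph_torus`** ∕ **`bound25_graph_torus`**: the union-resummed ℓ-line family
  obeys (24)∕(25) with every geometric hypothesis discharged — only the ℓ analytic leaves (23) and the thresholds remain.

WHAT IS NOT HERE (honest).  (i) The expansion, its graphs, vertices and the bound (23) for the lines are NOT constructed
(`WalkTermBound23` per line; GAPS G-B10-04); (ii) the INCIDENCE of a graph (which vertex cube anchors which line, shared by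
several lines) is NOT modelled: the union-resummed product ranges over INDEPENDENTLY anchored lines, of which the terms of a
given graph with prescribed incidences form a sub-collection — the file proves the bound for the larger positive majorant
family, which is how print's «Summing the expressions with the same localization X» is used; vertex factors (the O(g₀) of
(25)) ride in the lines' prefactors `A_i`; (iii) connectedness of the graph is replaced by the condition that the union of
the line localizations IS a localization domain (connected) — terms whose union is disconnected are not terms of (24)'s
sum over «Localizations X … connected unions of big blocks»; (iv) `ℓ` is a parameter (print: graphs from the sixth-order
cumulant); (v) constants are explicit but not optimized (rate halves: `κ∕2`, then `κ∕2 − 1` in (25)'s form).  Value = the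
finite-product version of the kernel edge (23) ⇒ (24)–(25) ⇒ (65)₁, by name, on the printed (periodic) carrier; NOT summit
progress; N08's located gap stays OBJECT-level (𝒫′₁, C^{(0)}, Z^{(0)} of (22)–(25), GAPS G-B10-03∕04).

## References
* [Balaban1985UV3] T. Bałaban, Commun. Math. Phys. 102 (1985) 255–275 — (23)–(25) p. 262, (65) p. 273.
* [Balaban1988RG2Cluster] T. Bałaban, Commun. Math. Phys. 116 (1988) 1–22 — (2.27) p. 18.
* [Dimock2013] J. Dimock, Rev. Math. Phys. 25 (2013) 1330010 — App. A Cor. 26 (anchored entropy sum, `B12TreeDecay`).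
* [Balaban1987RG1] T. Bałaban, Commun. Math. Phys. 109 (1987) 249–301 — p. 257 (cubes of the torus, `TreeLengthTorus`).
-/

noncomputable section

open Finset
open Literature.Probability.LatticeModels

namespace Literature.MathematicalPhysics.QuantumFieldTheory.Balaban1983to89.B10Eq24GraphTerms

open Literature.MathematicalPhysics.QuantumFieldTheory.Balaban1983to89
open Literature.MathematicalPhysics.QuantumFieldTheory.Balaban1983to89.B12TreeDecay (CubeSystem kappa₀ K₀ K₀_pos
  ineq126_touches)
open Literature.MathematicalPhysics.QuantumFieldTheory.Balaban1983to89.B10Eq25Rate (WalkTermBound23 activitiesOf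
  bound25_of_bound118)
open Literature.MathematicalPhysics.QuantumFieldTheory.Balaban1983to89.B10Eq25WalkGeometryTorus (State stateNbrs single
  domOf cubesQ card_cubesQ card_stateNbrs_torus_share_le card_anchors_le_one single_mem_cubesQ_domOf rescaleLaw_torus
  volBoundK1_torus)

/-! ## §1. Calculus: a power of `1 + t` against an exponential -/

/-- `(1 + t)^m · e^{−a t} ≤ m!·e^{a}∕a^m` for `t ≥ 0`, `a > 0` (from `y^m∕m! ≤ e^y` at `y = a(1+t)`). [folklore] -/
private theorem one_add_pow_mul_exp_neg_le {a : ℝ} (ha : 0 < a) (m : ℕ) {t : ℝ} (ht : 0 ≤ t) :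
    (1 + t) ^ m * Real.exp (-(a * t)) ≤ (m.factorial : ℝ) * Real.exp a / a ^ m := by
  have h := Real.pow_div_factorial_le_exp (a * (1 + t)) (by positivity) m
  rw [div_le_iff₀ (by positivity)] at h
  have haM : 0 < a ^ m := pow_pos ha m
  rw [le_div_iff₀ haM]
  have hexp : Real.exp (a * (1 + t)) * Real.exp (-(a * t)) = Real.exp a := by
    rw [← Real.exp_add]; ring_nf
  calc (1 + t) ^ m * Real.exp (-(a * t)) * a ^ m = (a * (1 + t)) ^ m * Real.exp (-(a * t)) := by
        rw [mul_pow]; ring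
    _ ≤ Real.exp (a * (1 + t)) * m.factorial * Real.exp (-(a * t)) :=
        mul_le_mul_of_nonneg_right h (Real.exp_nonneg _)
    _ = (m.factorial : ℝ) * Real.exp a := by rw [mul_comm (Real.exp _) (m.factorial : ℝ), mul_assoc, hexp]

/-! ## §2. The union-resummed product of `ℓ` localized families over a cube system -/

section Product

variable {D : LocDomainSys} (G : CubeSystem D) (ℓ : ℕ)

/-- «This localization is simply a union of all these sets» ([Balaban1985UV3] p. 262): the `ℓ`-tuples of localization
domains (one per line of the graph) whose families of blocks cover EXACTLY the blocks of `X`. [cite: Balaban1985UV3, p.262 (before (24))] -/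
def covTuples (X : D.Dom) : Finset (Fin ℓ → D.Dom) := by
  classical
  exact univ.filter fun t => (univ : Finset (Fin ℓ)).biUnion (fun i => G.cubes (t i)) = G.cubes X

variable {G ℓ}

/-- Membership in `covTuples`: the blocks of the components cover the blocks of `X`. [cite: Balaban1985UV3, p.262 (before (24); dictionary)] -/
theorem mem_covTuples {X : D.Dom} {t : Fin ℓ → D.Dom} :
    t ∈ covTuples G ℓ X ↔ (univ : Finset (Fin ℓ)).biUnion (fun i => G.cubes (t i)) = G.cubes X := by
  classical
  simp [covTuples]

/-- Every component of a covering tuple lies inside `X`. [cite: Balaban1985UV3, p.262 (before (24); bookkeeping)] -/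
theorem subset_of_mem_covTuples {X : D.Dom} {t : Fin ℓ → D.Dom} (ht : t ∈ covTuples G ℓ X) (i : Fin ℓ) :
    G.cubes (t i) ⊆ G.cubes X := by
  classical
  rw [← mem_covTuples.1 ht]
  exact subset_biUnion_of_mem (fun i => G.cubes (t i)) (mem_univ i)

variable (G ℓ)

/-- «Summing the expressions with the same localization X» for products: the UNION-RESUMMED PRODUCT of the localized
families `E_1, …, E_ℓ` (the lines of a graph), `Σ_{(Y_1,…,Y_ℓ) : ⋃ Y_i = X} Π_i E_i(Y_i, φ)` — the family indexed by the
localization `X` of the whole expression. [cite: Balaban1985UV3, (24) p.262] -/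
def prodFam {Φ : Type*} (E : Fin ℓ → D.Dom → Φ → ℂ) (X : D.Dom) (φ : Φ) : ℂ :=
  ∑ t ∈ covTuples G ℓ X, ∏ i, E i (t i) φ

end Product

/-! ## §3. The product version of the regrouping: `LogHalfBound` is stable under union-resummed bounded products -/

section Core

variable {D : LocDomainSys} {G : CubeSystem D} {ℓ : ℕ} {Φ : Type*} {sp : D.Dom → Set Φ}
  {E : Fin ℓ → D.Dom → Φ → ℂ} {B : Fin ℓ → ℝ} {Δ : ℕ} {c₀ r₁ κ : ℝ}

/-- Changing the count function by a constant factor: `LogHalfBound` with count `m·nX` and constant `B` is `LogHalfBound`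
with count `nX` and constant `B·m`. [folklore] -/
private theorem logHalfBound_count_mono {nX nX' : D.Dom → ℕ} {B m r : ℝ} (hB : 0 ≤ B) (hm : ∀ X, (nX' X : ℝ) ≤ m * nX X)
    {F : D.Dom → Φ → ℂ} (h : B13.LogHalfBound D sp F nX' B r) : B13.LogHalfBound D sp F nX (B * m) r := by
  intro X φ hφ
  calc ‖F X φ‖ ≤ B * (nX' X : ℝ) * Real.exp (-(r * D.dj X)) := h X φ hφ
    _ ≤ B * (m * nX X) * Real.exp (-(r * D.dj X)) := by
        gcongr
        exact hm X
    _ = B * m * (nX X : ℝ) * Real.exp (-(r * D.dj X)) := by ring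

/-- The coordinate sum of the `r₁`-parts: for `r₁ ≥ κ₀(c₀,Δ)` the domains INSIDE `X` carry total weight
`Σ_{Y ⊆ X} e^{−r₁ d(Y)} ≤ K₀(c₀,Δ)·#X` (each such `Y` meets `X`; `B12TreeDecay.ineq126_touches`). [cite: Dimock2013, App. A Cor. 26 (arXiv:1108.1335v2 TeX L3140–3157)] -/
theorem sum_inside_exp_le (hΔ : G.DegreeLE Δ) (hV : G.VolumeLeaf c₀) (hr₁ : kappa₀ c₀ Δ ≤ r₁) (X : D.Dom) :
    ∑ Y ∈ univ.filter (fun Y : D.Dom => G.cubes Y ⊆ G.cubes X), Real.exp (-(r₁ * D.dj Y))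
      ≤ K₀ c₀ Δ * (G.cubes X).card := by
  classical
  have hsub : univ.filter (fun Y : D.Dom => G.cubes Y ⊆ G.cubes X)
      ⊆ univ.filter (fun Y : D.Dom => (G.cubes Y ∩ G.cubes X).Nonempty) := by
    intro Y hY
    rw [mem_filter] at hY ⊢
    obtain ⟨c, hc⟩ := (G.connected Y).1
    exact ⟨mem_univ _, ⟨c, mem_inter.2 ⟨hc, hY.2 hc⟩⟩⟩
  calc ∑ Y ∈ univ.filter (fun Y : D.Dom => G.cubes Y ⊆ G.cubes X), Real.exp (-(r₁ * D.dj Y))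
      ≤ ∑ Y ∈ univ.filter (fun Y : D.Dom => (G.cubes Y ∩ G.cubes X).Nonempty), Real.exp (-(r₁ * D.dj Y)) :=
        sum_le_sum_of_subset_of_nonneg hsub fun _ _ _ => Real.exp_nonneg _
    _ = ∑ Y ∈ univ.filter (fun Y : D.Dom => (G.cubes Y ∩ G.cubes X).Nonempty), Real.exp (-r₁ * D.dj Y) := by
        refine sum_congr rfl fun Y _ => ?_
        rw [neg_mul]
    _ ≤ K₀ c₀ Δ * (G.cubes X).card := ineq126_touches G hΔ hV hr₁ (G.cubes X)

/-- **(24) FOR SEVERAL LINES — the product version of the regrouping.**  Over a cube system with wall-degree `≤ Δ` and the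
volume leaf `|Y| ≤ c₀(1 + d(Y))`, under the gluing hypothesis (2.27) for covering tuples and the space-restriction
hypothesis: if each of the `ℓ ≥ 1` localized families obeys `B13.LogHalfBound` with constant `B_i ≥ 0` at rate `r₁ + κ`
(`r₁ ≥ κ₀(c₀,Δ)`, `κ > 0`), then their union-resummed product obeys `B13.LogHalfBound` with count `#blocks`, rate `κ∕2` and
constant `(Π_i B_i)·K₀(c₀,Δ)^ℓ·e^{2κ(ℓ−1)}·(c₀^{2ℓ−1}·(2ℓ−1)!·e^{κ∕2}∕(κ∕2)^{2ℓ−1})` — «It is easy to see that, because of the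
bound (23), the expressions corresponding to big localization sets X are very small … Summing the expressions with the same
localization X we get finally the inequality (24)». [cite: Balaban1985UV3, (24) p.262] -/
theorem logHalfBound_prodFam (hℓ : 1 ≤ ℓ) (hΔ : G.DegreeLE Δ) (hV : G.VolumeLeaf c₀)
    (hglue : ∀ (X : D.Dom) (t : Fin ℓ → D.Dom), t ∈ covTuples G ℓ X → D.dj X + 2 ≤ ∑ i, (D.dj (t i) + 2))
    (hsp : ∀ X Y : D.Dom, G.cubes Y ⊆ G.cubes X → sp X ⊆ sp Y) (hB : ∀ i, 0 ≤ B i) (hr₁ : kappa₀ c₀ Δ ≤ r₁) (hκ : 0 < κ)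
    (hE : ∀ i, B13.LogHalfBound D sp (E i) (fun Y => (G.cubes Y).card) (B i) (r₁ + κ)) :
    B13.LogHalfBound D sp (prodFam G ℓ E) (fun X => (G.cubes X).card)
      ((∏ i, B i) * K₀ c₀ Δ ^ ℓ * Real.exp (2 * κ * (ℓ - 1)) *
        (c₀ ^ (2 * ℓ - 1) * ((2 * ℓ - 1).factorial : ℝ) * Real.exp (κ / 2) / (κ / 2) ^ (2 * ℓ - 1)))
      (κ / 2) := by
  classical
  intro X φ hφ
  -- shorthand
  set n : ℝ := ((G.cubes X).card : ℝ) with hn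
  set d : ℝ := D.dj X with hd
  have hd0 : 0 ≤ d := D.dj_nonneg X
  have hn1 : (1 : ℝ) ≤ n := by
    have := G.vol_pos X
    rw [hn]; exact_mod_cast this
  have hn0 : 0 ≤ n := le_trans zero_le_one hn1
  have hK : 0 < K₀ c₀ Δ := K₀_pos c₀ Δ
  have hPB : 0 ≤ ∏ i, B i := prod_nonneg fun i _ => hB i
  -- `c₀ > 0` from the volume leaf at `X`
  have hc₀ : 0 < c₀ := by
    have h1 : (1 : ℝ) ≤ c₀ * (1 + d) := hn1.trans (hV X)
    by_contra hc
    have hc' : c₀ ≤ 0 := not_lt.mp hc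
    have : c₀ * (1 + d) ≤ 0 := mul_nonpos_of_nonpos_of_nonneg hc' (by linarith)
    linarith
  -- Step 1: pointwise bound on each summand of `prodFam`
  set S : Finset D.Dom := univ.filter (fun Y : D.Dom => G.cubes Y ⊆ G.cubes X) with hS
  have hstep : ∀ t ∈ covTuples G ℓ X,
      ‖∏ i, E i (t i) φ‖ ≤ (∏ i, B i) * n ^ ℓ * (Real.exp (2 * κ * (ℓ - 1)) * Real.exp (-(κ * d))) *
        ∏ i, Real.exp (-(r₁ * D.dj (t i))) := by
    intro t ht
    have hsub : ∀ i, G.cubes (t i) ⊆ G.cubes X := subset_of_mem_covTuples ht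
    -- each factor
    have hfac : ∀ i, ‖E i (t i) φ‖ ≤ B i * n * (Real.exp (-(κ * D.dj (t i))) * Real.exp (-(r₁ * D.dj (t i)))) := by
      intro i
      have hφi : φ ∈ sp (t i) := hsp X (t i) (hsub i) hφ
      have h1 := hE i (t i) φ hφi
      have hcard : ((G.cubes (t i)).card : ℝ) ≤ n := by
        rw [hn]; exact_mod_cast card_le_card (hsub i)
      calc ‖E i (t i) φ‖ ≤ B i * ((G.cubes (t i)).card : ℝ) * Real.exp (-((r₁ + κ) * D.dj (t i))) := h1
        _ ≤ B i * n * Real.exp (-((r₁ + κ) * D.dj (t i))) := by gcongr; exact hB i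
        _ = B i * n * (Real.exp (-(κ * D.dj (t i))) * Real.exp (-(r₁ * D.dj (t i)))) := by
            rw [← Real.exp_add]; ring_nf
    -- the product of the factor bounds
    have hprod : ‖∏ i, E i (t i) φ‖ ≤ ∏ i, (B i * n * (Real.exp (-(κ * D.dj (t i))) * Real.exp (-(r₁ * D.dj (t i))))) := by
      rw [norm_prod]
      exact prod_le_prod (fun i _ => norm_nonneg _) fun i _ => hfac i
    -- regroup the product
    have hexpsum : ∏ i, Real.exp (-(κ * D.dj (t i))) = Real.exp (-(κ * ∑ i, D.dj (t i))) := by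
      rw [mul_sum, ← sum_neg_distrib, Real.exp_sum]
    have hregroup : ∏ i, (B i * n * (Real.exp (-(κ * D.dj (t i))) * Real.exp (-(r₁ * D.dj (t i)))))
        = (∏ i, B i) * n ^ ℓ * Real.exp (-(κ * ∑ i, D.dj (t i))) * ∏ i, Real.exp (-(r₁ * D.dj (t i))) := by
      rw [prod_mul_distrib, prod_mul_distrib, prod_mul_distrib, prod_const, card_univ, Fintype.card_fin, hexpsum]
      ring
    -- the gluing step: κ Σ d(t_i) ≥ κ (d + 2 - 2ℓ)
    have hg := hglue X t ht
    have hsumd : d + 2 - 2 * ℓ ≤ ∑ i, D.dj (t i) := by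
      rw [sum_add_distrib, sum_const, card_univ, Fintype.card_fin, nsmul_eq_mul] at hg
      linarith
    have hexpglue : Real.exp (-(κ * ∑ i, D.dj (t i))) ≤ Real.exp (2 * κ * (ℓ - 1)) * Real.exp (-(κ * d)) := by
      rw [← Real.exp_add]
      apply Real.exp_le_exp.2
      have := mul_le_mul_of_nonneg_left hsumd hκ.le
      nlinarith
    calc ‖∏ i, E i (t i) φ‖ ≤ _ := hprod
      _ = (∏ i, B i) * n ^ ℓ * Real.exp (-(κ * ∑ i, D.dj (t i))) * ∏ i, Real.exp (-(r₁ * D.dj (t i))) := hregroup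
      _ ≤ (∏ i, B i) * n ^ ℓ * (Real.exp (2 * κ * (ℓ - 1)) * Real.exp (-(κ * d))) *
            ∏ i, Real.exp (-(r₁ * D.dj (t i))) := by
          gcongr
  -- Step 2: the sum of the `r₁`-parts over covering tuples ≤ over ALL tuples inside X = product of coordinate sums
  have hcovsub : covTuples G ℓ X ⊆ Fintype.piFinset (fun _ : Fin ℓ => S) := by
    intro t ht
    rw [Fintype.mem_piFinset]
    intro i
    rw [hS, mem_filter]
    exact ⟨mem_univ _, subset_of_mem_covTuples ht i⟩
  have hsumr : ∑ t ∈ covTuples G ℓ X, ∏ i, Real.exp (-(r₁ * D.dj (t i))) ≤ (K₀ c₀ Δ * n) ^ ℓ := by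
    calc ∑ t ∈ covTuples G ℓ X, ∏ i, Real.exp (-(r₁ * D.dj (t i)))
        ≤ ∑ t ∈ Fintype.piFinset (fun _ : Fin ℓ => S), ∏ i, Real.exp (-(r₁ * D.dj (t i))) :=
          sum_le_sum_of_subset_of_nonneg hcovsub fun _ _ _ => prod_nonneg fun _ _ => Real.exp_nonneg _
      _ = ∏ _i : Fin ℓ, ∑ Y ∈ S, Real.exp (-(r₁ * D.dj Y)) := by rw [Finset.prod_univ_sum]
      _ ≤ ∏ _i : Fin ℓ, (K₀ c₀ Δ * n) :=
          prod_le_prod (fun _ _ => sum_nonneg fun _ _ => Real.exp_nonneg _)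
            fun _ _ => sum_inside_exp_le hΔ hV hr₁ X
      _ = (K₀ c₀ Δ * n) ^ ℓ := by rw [prod_const, card_univ, Fintype.card_fin]
  -- Step 3: assemble
  have hmain : ‖prodFam G ℓ E X φ‖ ≤ (∏ i, B i) * K₀ c₀ Δ ^ ℓ * Real.exp (2 * κ * (ℓ - 1)) *
      (n ^ (2 * ℓ) * Real.exp (-(κ * d))) := by
    unfold prodFam
    calc ‖∑ t ∈ covTuples G ℓ X, ∏ i, E i (t i) φ‖ ≤ ∑ t ∈ covTuples G ℓ X, ‖∏ i, E i (t i) φ‖ := norm_sum_le _ _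
      _ ≤ ∑ t ∈ covTuples G ℓ X, (∏ i, B i) * n ^ ℓ * (Real.exp (2 * κ * (ℓ - 1)) * Real.exp (-(κ * d))) *
            ∏ i, Real.exp (-(r₁ * D.dj (t i))) := sum_le_sum hstep
      _ = (∏ i, B i) * n ^ ℓ * (Real.exp (2 * κ * (ℓ - 1)) * Real.exp (-(κ * d))) *
            ∑ t ∈ covTuples G ℓ X, ∏ i, Real.exp (-(r₁ * D.dj (t i))) := by rw [mul_sum]
      _ ≤ (∏ i, B i) * n ^ ℓ * (Real.exp (2 * κ * (ℓ - 1)) * Real.exp (-(κ * d))) * (K₀ c₀ Δ * n) ^ ℓ := by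
            gcongr
      _ = (∏ i, B i) * K₀ c₀ Δ ^ ℓ * Real.exp (2 * κ * (ℓ - 1)) * (n ^ (2 * ℓ) * Real.exp (-(κ * d))) := by
            rw [mul_pow]; ring
  -- Step 4: the surplus power of n against half the rate
  have hsurplus : n ^ (2 * ℓ) * Real.exp (-(κ * d)) ≤
      (c₀ ^ (2 * ℓ - 1) * ((2 * ℓ - 1).factorial : ℝ) * Real.exp (κ / 2) / (κ / 2) ^ (2 * ℓ - 1)) *
        (n * Real.exp (-(κ / 2 * d))) := by
    have h2ℓ : 2 * ℓ = (2 * ℓ - 1) + 1 := by omega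
    have hnle : n ≤ c₀ * (1 + d) := hV X
    have hpow : n ^ (2 * ℓ - 1) ≤ (c₀ * (1 + d)) ^ (2 * ℓ - 1) := pow_le_pow_left₀ hn0 hnle _
    have hcalc := one_add_pow_mul_exp_neg_le (half_pos hκ) (2 * ℓ - 1) hd0
    have hsplit : Real.exp (-(κ * d)) = Real.exp (-(κ / 2 * d)) * Real.exp (-(κ / 2 * d)) := by
      rw [← Real.exp_add]; ring_nf
    have hpow_split : n ^ (2 * ℓ) = n ^ (2 * ℓ - 1) * n := by
      rw [← pow_succ, ← h2ℓ]
    have hne : 0 ≤ n * Real.exp (-(κ / 2 * d)) := mul_nonneg hn0 (Real.exp_nonneg _)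
    calc n ^ (2 * ℓ) * Real.exp (-(κ * d)) = n ^ (2 * ℓ - 1) * Real.exp (-(κ / 2 * d)) * (n * Real.exp (-(κ / 2 * d))) := by
          rw [hpow_split, hsplit]; ring
      _ ≤ (c₀ * (1 + d)) ^ (2 * ℓ - 1) * Real.exp (-(κ / 2 * d)) * (n * Real.exp (-(κ / 2 * d))) :=
          mul_le_mul_of_nonneg_right (mul_le_mul_of_nonneg_right hpow (Real.exp_nonneg _)) hne
      _ = c₀ ^ (2 * ℓ - 1) * ((1 + d) ^ (2 * ℓ - 1) * Real.exp (-(κ / 2 * d))) * (n * Real.exp (-(κ / 2 * d))) := by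
          rw [mul_pow]; ring
      _ ≤ c₀ ^ (2 * ℓ - 1) * (((2 * ℓ - 1).factorial : ℝ) * Real.exp (κ / 2) / (κ / 2) ^ (2 * ℓ - 1)) *
            (n * Real.exp (-(κ / 2 * d))) :=
          mul_le_mul_of_nonneg_right (mul_le_mul_of_nonneg_left hcalc (pow_nonneg hc₀.le _)) hne
      _ = _ := by ring
  calc ‖prodFam G ℓ E X φ‖ ≤ _ := hmain
    _ ≤ (∏ i, B i) * K₀ c₀ Δ ^ ℓ * Real.exp (2 * κ * (ℓ - 1)) *
          ((c₀ ^ (2 * ℓ - 1) * ((2 * ℓ - 1).factorial : ℝ) * Real.exp (κ / 2) / (κ / 2) ^ (2 * ℓ - 1)) *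
            (n * Real.exp (-(κ / 2 * d)))) :=
        mul_le_mul_of_nonneg_left hsurplus
          (mul_nonneg (mul_nonneg hPB (pow_nonneg hK.le _)) (Real.exp_nonneg _))
    _ = _ := by rw [hn, hd]; ring

end Core

/-! ## §4. The torus: (2.27) for covering tuples is a theorem; the product regrouping on the periodic carrier -/

section Torus

open TreeLengthTorus

variable {d N : ℕ} [NeZero N] {ℓ : ℕ}

/-- **(2.27) FOR COVERING TUPLES ON THE TORUS** — for an `ℓ`-tuple of torus localization
domains whose blocks cover exactly the blocks of the torus localization domain `X`, `d(X) + 2 ≤ Σ_i (d(t_i) + 2)`; from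
`TreeLengthTorusGeometry.torusTreeLen_biUnion_add_two_le` applied to the IMAGE family of the tuple (repeated components only
enlarge the right-hand side). [cite: Balaban1988RG2Cluster, (2.27) p.18] -/
theorem glue227_torus (d N ℓ : ℕ) [NeZero N] (X : (tsys d N).Dom) (t : Fin ℓ → (tsys d N).Dom)
    (ht : t ∈ covTuples (tcubeSys d N) ℓ X) : (tsys d N).dj X + 2 ≤ ∑ i, ((tsys d N).dj (t i) + 2) := by
  classical
  have hcov : (univ : Finset (Fin ℓ)).biUnion (fun i => (t i).1) = X.1 := mem_covTuples.1 ht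
  -- the image family
  set Dfam : Finset (Finset (TPt d N)) := univ.image (fun i => (t i).1) with hDfam
  have hU : Dfam.biUnion id = X.1 := by
    rw [hDfam, Finset.image_biUnion]
    simpa using hcov
  have hℓ : 0 < ℓ := by
    by_contra h0
    have h0' : ℓ = 0 := by omega
    subst h0'
    have hempty : (univ : Finset (Fin 0)).biUnion (fun i => (t i).1) = ∅ := by simp
    rw [hempty] at hcov
    exact X.2.1.ne_empty hcov.symm
  have hDne : Dfam.Nonempty := by
    rw [hDfam]
    exact (univ_nonempty_iff.2 ⟨⟨0, hℓ⟩⟩).image _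
  have hmem : ∀ Y ∈ Dfam, Y.Nonempty ∧ TFaceConnected Y := by
    intro Y hY
    obtain ⟨i, -, rfl⟩ := mem_image.1 hY
    exact (t i).2
  have hconn : TFaceConnected (Dfam.biUnion id) := by rw [hU]; exact X.2.2
  have h := TreeLengthTorusGeometry.torusTreeLen_biUnion_add_two_le hDne hmem hconn
  rw [hU] at h
  have himg : ∑ Y ∈ Dfam, (torusTreeLen Y + 2) ≤ ∑ i, (torusTreeLen (t i).1 + 2) := by
    rw [hDfam]
    exact sum_image_le_of_nonneg fun Y _ => by linarith [torusTreeLen_nonneg Y]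
  simpa only [tsys_dj] using h.trans himg

variable {Φ : Type*} {sp : (tsys d N).Dom → Set Φ} {E : Fin ℓ → (tsys d N).Dom → Φ → ℂ} {B : Fin ℓ → ℝ} {r₁ κ : ℝ}

/-- **(24) FOR SEVERAL LINES ON THE TORUS**: `logHalfBound_prodFam` on the periodic carrier with Δ = 2d, c₀ = 4·2^d
(`tdegreeLE`, `tvolumeLeaf`), the gluing (2.27) DISCHARGED (`glue227_torus`); the space-restriction hypothesis and the factor
bounds (rate `r₁ + κ`, `r₁ ≥ κ₀(4·2^d, 2d)`, `κ > 0`) remain. [cite: Balaban1985UV3, (24) p.262] -/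
theorem logHalfBound_prodFam_torus (hℓ : 1 ≤ ℓ) (hsp : ∀ X Y : (tsys d N).Dom, (tcubeSys d N).cubes Y ⊆ (tcubeSys d N).cubes X → sp X ⊆ sp Y) (hB : ∀ i, 0 ≤ B i)
    (hr₁ : kappa₀ (4 * 2 ^ d) (2 * d) ≤ r₁) (hκ : 0 < κ)
    (hE : ∀ i, B13.LogHalfBound (tsys d N) sp (E i) (fun Y => ((tcubeSys d N).cubes Y).card) (B i) (r₁ + κ)) :
    B13.LogHalfBound (tsys d N) sp (prodFam (tcubeSys d N) ℓ E) (fun X => ((tcubeSys d N).cubes X).card)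
      ((∏ i, B i) * K₀ (4 * 2 ^ d) (2 * d) ^ ℓ * Real.exp (2 * κ * (ℓ - 1)) *
        (((4 : ℝ) * 2 ^ d) ^ (2 * ℓ - 1) * ((2 * ℓ - 1).factorial : ℝ) * Real.exp (κ / 2) / (κ / 2) ^ (2 * ℓ - 1)))
      (κ / 2) :=
  logHalfBound_prodFam hℓ (tdegreeLE d N) (tvolumeLeaf d N) (fun X t ht => glue227_torus d N ℓ X t ht) hsp hB hr₁ hκ hE

end Torus

/-! ## §5. (25) and the first clause of (65) for the union-resummed product on the torus -/

section Carrier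

open TreeLengthTorus

variable {d N : ℕ} [NeZero N] {ℓ : ℕ} {Φ : Type} {sp : (tsys d N).Dom → Set Φ}
  {E : Fin ℓ → (tsys d N).Dom → Φ → ℂ} {B : Fin ℓ → ℝ} {r₁ κ g : ℝ} {R : Set Φ}

/-- The volume law for the block count on the torus IS `tvolumeLeaf` (`B13.VolBoundK1` with c₁ = 4·2^d). [cite: Balaban1988RG2Cluster, (2.30) p.18 (lower half, repaired form)] -/
theorem volBoundK1_blocks_torus (d N : ℕ) [NeZero N] :
    B13.VolBoundK1 (tsys d N) (fun X => ((tcubeSys d N).cubes X).card) (4 * 2 ^ d) :=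
  fun X => tvolumeLeaf d N X

/-- **(25) FOR SEVERAL LINES ON THE TORUS**: the union-resummed product of `ℓ` families obeying `LogHalfBound` (rate
`r₁ + κ`, `r₁ ≥ κ₀(4·2^d,2d)`, `κ > 0`) obeys `B10.Bound25Printed` on the induced activities at the real configurations
`R ⊆ sp X`, with rate `κ∕2 − 1` and constant `E₀∕g`, `E₀ = B'·4·2^d` (`B'` the constant of `logHalfBound_prodFam_torus`) —
`B13.bound118_of_logHalfBound` + `B10Eq25Rate.bound25_of_bound118` BY NAME. [cite: Balaban1985UV3, (25) p.262] -/
theorem bound25_prodFam_torus (hℓ : 1 ≤ ℓ) (hsp : ∀ X Y : (tsys d N).Dom, (tcubeSys d N).cubes Y ⊆ (tcubeSys d N).cubes X → sp X ⊆ sp Y) (hB : ∀ i, 0 ≤ B i)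
    (hr₁ : kappa₀ (4 * 2 ^ d) (2 * d) ≤ r₁) (hκ : 0 < κ) (hg : 0 < g) (hR : ∀ X, R ⊆ sp X)
    (hE : ∀ i, B13.LogHalfBound (tsys d N) sp (E i) (fun Y => ((tcubeSys d N).cubes Y).card) (B i) (r₁ + κ)) :
    B10.Bound25Printed (activitiesOf (tsys d N) (prodFam (tcubeSys d N) ℓ E) R) g (κ / 2 - 1)
      ((∏ i, B i) * K₀ (4 * 2 ^ d) (2 * d) ^ ℓ * Real.exp (2 * κ * (ℓ - 1)) *
        (((4 : ℝ) * 2 ^ d) ^ (2 * ℓ - 1) * ((2 * ℓ - 1).factorial : ℝ) * Real.exp (κ / 2) / (κ / 2) ^ (2 * ℓ - 1)) *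
        (4 * 2 ^ d) / g) := by
  have hlog := logHalfBound_prodFam_torus hℓ hsp hB hr₁ hκ hE
  have hB' : 0 ≤ (∏ i, B i) * K₀ (4 * 2 ^ d) (2 * d) ^ ℓ * Real.exp (2 * κ * (ℓ - 1)) *
      (((4 : ℝ) * 2 ^ d) ^ (2 * ℓ - 1) * ((2 * ℓ - 1).factorial : ℝ) * Real.exp (κ / 2) / (κ / 2) ^ (2 * ℓ - 1)) := by
    have hPB : 0 ≤ ∏ i, B i := prod_nonneg fun i _ => hB i
    have hK : 0 ≤ K₀ (4 * 2 ^ d) (2 * d) := (K₀_pos _ _).le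
    positivity
  have h118 := B13.bound118_of_logHalfBound (tsys d N) sp _ _ hB' hlog (volBoundK1_blocks_torus d N)
  exact bound25_of_bound118 hR hg h118

/-- **(65)₁ FOR SEVERAL LINES ON THE TORUS** («|E^{(j)}| ≤ O(1)|T₁^{(j)}|», p. 273): `‖Σ_X prodFam(X, U)‖ ≤ E₀·K₀(4·2^d,2d)·N^d`
at every real configuration, for `κ∕2 − 1 ≥ κ₀(4·2^d, 2d)` — `B10Eq65PolymerSum.norm_total_le_of_bound25` over `tcubeSys`
BY NAME. [cite: Balaban1985UV3, (65) p.273] -/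
theorem norm_total_prodFam_torus (hℓ : 1 ≤ ℓ) (hsp : ∀ X Y : (tsys d N).Dom, (tcubeSys d N).cubes Y ⊆ (tcubeSys d N).cubes X → sp X ⊆ sp Y) (hB : ∀ i, 0 ≤ B i)
    (hr₁ : kappa₀ (4 * 2 ^ d) (2 * d) ≤ r₁) (hκ : 0 < κ) (hg : 0 < g) (hR : ∀ X, R ⊆ sp X)
    (hκ' : kappa₀ (4 * 2 ^ d) (2 * d) ≤ κ / 2 - 1)
    (hE : ∀ i, B13.LogHalfBound (tsys d N) sp (E i) (fun Y => ((tcubeSys d N).cubes Y).card) (B i) (r₁ + κ))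
    (U : R) :
    ‖∑ X : (tsys d N).Dom, prodFam (tcubeSys d N) ℓ E X (U : Φ)‖
      ≤ ((∏ i, B i) * K₀ (4 * 2 ^ d) (2 * d) ^ ℓ * Real.exp (2 * κ * (ℓ - 1)) *
        (((4 : ℝ) * 2 ^ d) ^ (2 * ℓ - 1) * ((2 * ℓ - 1).factorial : ℝ) * Real.exp (κ / 2) / (κ / 2) ^ (2 * ℓ - 1)) *
        (4 * 2 ^ d) / g) * g * K₀ (4 * 2 ^ d) (2 * d) * (N ^ d : ℕ) := by
  have h25 := bound25_prodFam_torus hℓ hsp hB hr₁ hκ hg hR hE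
  have hCg : 0 ≤ ((∏ i, B i) * K₀ (4 * 2 ^ d) (2 * d) ^ ℓ * Real.exp (2 * κ * (ℓ - 1)) *
        (((4 : ℝ) * 2 ^ d) ^ (2 * ℓ - 1) * ((2 * ℓ - 1).factorial : ℝ) * Real.exp (κ / 2) / (κ / 2) ^ (2 * ℓ - 1)) *
        (4 * 2 ^ d) / g) * g := by
    have hPB : 0 ≤ ∏ i, B i := prod_nonneg fun i _ => hB i
    have hK : 0 ≤ K₀ (4 * 2 ^ d) (2 * d) := (K₀_pos _ _).le
    positivity
  have h := B10Eq65PolymerSum.norm_total_le_of_bound25 (tcubeSys d N) (tdegreeLE d N) (tvolumeLeaf d N) hκ' _ R hCg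
    h25 U
  rwa [card_tcube] at h

end Carrier

/-! ## §6. The p. 262 reading: lines = anchored walk families obeying (23); the graph family = their union product -/

section Lines

open TreeLengthTorus

variable {d N : ℕ} [NeZero N] {Λ : Type} [Fintype Λ] [DecidableEq Λ] {s₀ : ℕ} {Φ : Type}
  {sp : (tsys d N).Dom → Set Φ}

/-- **One LINE on the torus**: a family of anchored walk terms over the share-a-block walk states of
`B10Eq25WalkGeometryTorus` obeying the bound (23) with prefactor `A` — «A term in the expression, corresponding to the walk
ω, satisfies the bound (3.108) [5], i.e. can be bounded by (23)» — regrouped by localization (`B10LogDet63.Elog`) obeys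
`B13.LogHalfBound` with the BLOCK count, any rate `κ ≥ 0` and constant `2·A·C·e^{κs₀}·|Λ|`, once `M₁ ≥ 2·D𝔤·c·e^{κs₀}`,
`D𝔤 = |Λ|·s₀·(2d+1)^{2(s₀−1)}`: `B10Eq25Rate.rate25` with `hD`, `hV`, `hstart`, `hsc` DISCHARGED on the torus and the
labelled count `#cubesQ = |Λ|·#blocks` rescaled. [cite: Balaban1985UV3, (23)–(25) p.262] -/
theorem logHalfBound_line_torus (hs : 1 ≤ s₀)
    {term : Λ × TPt d N → List (State Λ (TAdj (d := d) (N := N)) s₀) → Φ → ℂ}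
    {wd : Λ × TPt d N → List (State Λ (TAdj (d := d) (N := N)) s₀) → ℝ} (hwd : ∀ p ω, 0 ≤ wd p ω)
    {A C c M δ₀ κ : ℝ} (hM : 0 < M) (hA : 0 ≤ A) (hC : 0 ≤ C) (hc : 0 ≤ c) (hδ₀ : 0 < δ₀) (hκ : 0 ≤ κ)
    (hMent : 2 * (((Fintype.card Λ * (s₀ * (2 * d + 1) ^ (2 * (s₀ - 1))) : ℕ) : ℝ) * (c * Real.exp (κ * s₀))) ≤ M)
    (h23 : WalkTermBound23 (tsys d N) (stateNbrs (fun _ _ => False) TAdj s₀) (single hs) (domOf hs) sp term wd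
      A C c M δ₀) :
    B13.LogHalfBound (tsys d N) sp
      (B10LogDet63.Elog (stateNbrs (fun _ _ => False) TAdj s₀) (single hs) (domOf hs) term)
      (fun X => ((tcubeSys d N).cubes X).card) (2 * (A * C * Real.exp (κ * s₀)) * Fintype.card Λ) κ := by
  have hMκ : 2 * κ * 0 / δ₀ ≤ M := by simp; exact hM.le
  have h := B10Eq25Rate.rate25 (cubes := cubesQ hs)
    (Dg := Fintype.card Λ * (s₀ * (2 * d + 1) ^ (2 * (s₀ - 1)))) (V := 1)
    (fun q => card_stateNbrs_torus_share_le s₀ q) (fun q => card_anchors_le_one hs q)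
    (fun p n ω hω => single_mem_cubesQ_domOf hs p n ω hω) hM hA hC hc hδ₀ hκ hMκ hMent h23
    (rescaleLaw_torus hs wd hwd hM.le)
  simp only [Nat.cast_one, mul_one] at h
  refine logHalfBound_count_mono (by positivity) (fun X => ?_) h
  rw [card_cubesQ, tcubeSys_cubes]
  push_cast
  exact le_rfl

variable {ℓ : ℕ}

/-- **(24) FOR A GRAPH WITH `ℓ` LINES ON THE TORUS, every geometric hypothesis discharged** — «The localizations {□_j} and
the walks ω replacing lines of the graph define a localization X … simply a union of all these sets … Summing the
expressions with the same localization X»: if each of the `ℓ ≥ 1` lines obeys (23) with prefactor `A_i` (common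
`C, c, M₁, δ₀`, share-a-block states of size `s₀`), then for every `κ > 0` with `M₁ ≥ 2·D𝔤·c·e^{(κ₀+κ)s₀}` (`κ₀ =
κ₀(4·2^d,2d)`) the union-resummed family of the ℓ line families obeys `B13.LogHalfBound` with the block count, rate `κ∕2`
and the constant of `logHalfBound_prodFam_torus` at `B_i = 2·A_i·C·e^{(κ₀+κ)s₀}·|Λ|`; only the ℓ analytic leaves (23), the
space restriction and the thresholds remain. [cite: Balaban1985UV3, (24) p.262] -/
theorem logHalfBound_graph_torus (hℓ : 1 ≤ ℓ) (hs : 1 ≤ s₀) (hsp : ∀ X Y : (tsys d N).Dom, (tcubeSys d N).cubes Y ⊆ (tcubeSys d N).cubes X → sp X ⊆ sp Y)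
    {term : Fin ℓ → Λ × TPt d N → List (State Λ (TAdj (d := d) (N := N)) s₀) → Φ → ℂ}
    {wd : Fin ℓ → Λ × TPt d N → List (State Λ (TAdj (d := d) (N := N)) s₀) → ℝ} (hwd : ∀ i p ω, 0 ≤ wd i p ω)
    {A : Fin ℓ → ℝ} {C c M δ₀ κ : ℝ} (hM : 0 < M) (hA : ∀ i, 0 ≤ A i) (hC : 0 ≤ C) (hc : 0 ≤ c) (hδ₀ : 0 < δ₀)
    (hκ : 0 < κ)
    (hMent : 2 * (((Fintype.card Λ * (s₀ * (2 * d + 1) ^ (2 * (s₀ - 1))) : ℕ) : ℝ) *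
      (c * Real.exp ((kappa₀ (4 * 2 ^ d) (2 * d) + κ) * s₀))) ≤ M)
    (h23 : ∀ i, WalkTermBound23 (tsys d N) (stateNbrs (fun _ _ => False) TAdj s₀) (single hs) (domOf hs) sp (term i)
      (wd i) (A i) C c M δ₀) :
    B13.LogHalfBound (tsys d N) sp
      (prodFam (tcubeSys d N) ℓ
        (fun i => B10LogDet63.Elog (stateNbrs (fun _ _ => False) TAdj s₀) (single hs) (domOf hs) (term i)))
      (fun X => ((tcubeSys d N).cubes X).card)
      ((∏ i, (2 * (A i * C * Real.exp ((kappa₀ (4 * 2 ^ d) (2 * d) + κ) * s₀)) * Fintype.card Λ)) *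
          K₀ (4 * 2 ^ d) (2 * d) ^ ℓ * Real.exp (2 * κ * (ℓ - 1)) *
        (((4 : ℝ) * 2 ^ d) ^ (2 * ℓ - 1) * ((2 * ℓ - 1).factorial : ℝ) * Real.exp (κ / 2) / (κ / 2) ^ (2 * ℓ - 1)))
      (κ / 2) := by
  have hκ₀ : 0 ≤ kappa₀ (4 * 2 ^ d) (2 * d) := B12TreeDecay.kappa₀_nonneg (by positivity) _
  refine logHalfBound_prodFam_torus hℓ hsp (fun i => by have := hA i; positivity) le_rfl hκ fun i => ?_
  exact logHalfBound_line_torus hs (hwd i) hM (hA i) hC hc hδ₀ (by positivity) hMent (h23 i)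

/-- **(25) FOR A GRAPH WITH `ℓ` LINES ON THE TORUS**: under the hypotheses of `logHalfBound_graph_torus`, for the real
configurations `R ⊆ sp X` and `g > 0`, the union-resummed ℓ-line family obeys `B10.Bound25Printed` with rate `κ∕2 − 1`
(`bound25_prodFam_torus`). [cite: Balaban1985UV3, (25) p.262] -/
theorem bound25_graph_torus (hℓ : 1 ≤ ℓ) (hs : 1 ≤ s₀) (hsp : ∀ X Y : (tsys d N).Dom, (tcubeSys d N).cubes Y ⊆ (tcubeSys d N).cubes X → sp X ⊆ sp Y)
    {term : Fin ℓ → Λ × TPt d N → List (State Λ (TAdj (d := d) (N := N)) s₀) → Φ → ℂ}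
    {wd : Fin ℓ → Λ × TPt d N → List (State Λ (TAdj (d := d) (N := N)) s₀) → ℝ} (hwd : ∀ i p ω, 0 ≤ wd i p ω)
    {A : Fin ℓ → ℝ} {C c M δ₀ κ g : ℝ} {R : Set Φ} (hM : 0 < M) (hA : ∀ i, 0 ≤ A i) (hC : 0 ≤ C) (hc : 0 ≤ c)
    (hδ₀ : 0 < δ₀) (hκ : 0 < κ) (hg : 0 < g) (hR : ∀ X, R ⊆ sp X)
    (hMent : 2 * (((Fintype.card Λ * (s₀ * (2 * d + 1) ^ (2 * (s₀ - 1))) : ℕ) : ℝ) *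
      (c * Real.exp ((kappa₀ (4 * 2 ^ d) (2 * d) + κ) * s₀))) ≤ M)
    (h23 : ∀ i, WalkTermBound23 (tsys d N) (stateNbrs (fun _ _ => False) TAdj s₀) (single hs) (domOf hs) sp (term i)
      (wd i) (A i) C c M δ₀) :
    B10.Bound25Printed
      (activitiesOf (tsys d N)
        (prodFam (tcubeSys d N) ℓ
          (fun i => B10LogDet63.Elog (stateNbrs (fun _ _ => False) TAdj s₀) (single hs) (domOf hs) (term i))) R)
      g (κ / 2 - 1)
      ((∏ i, (2 * (A i * C * Real.exp ((kappa₀ (4 * 2 ^ d) (2 * d) + κ) * s₀)) * Fintype.card Λ)) *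
          K₀ (4 * 2 ^ d) (2 * d) ^ ℓ * Real.exp (2 * κ * (ℓ - 1)) *
        (((4 : ℝ) * 2 ^ d) ^ (2 * ℓ - 1) * ((2 * ℓ - 1).factorial : ℝ) * Real.exp (κ / 2) / (κ / 2) ^ (2 * ℓ - 1)) *
        (4 * 2 ^ d) / g) := by
  have hκ₀ : 0 ≤ kappa₀ (4 * 2 ^ d) (2 * d) := B12TreeDecay.kappa₀_nonneg (by positivity) _
  refine bound25_prodFam_torus hℓ hsp (fun i => by have := hA i; positivity) le_rfl hκ hg hR fun i => ?_
  exact logHalfBound_line_torus hs (hwd i) hM (hA i) hC hc hδ₀ (by positivity) hMent (h23 i)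

end Lines

end Literature.MathematicalPhysics.QuantumFieldTheory.Balaban1983to89.B10Eq24GraphTerms

end
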